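import Literature.IUT.HodgeTheaters.TemperedCoveringsCor23KerLevelOfHPrimeInputs
import HarnessLib

/-!
# [IUTchI] Cor. 2.3 (iii) (and the (i)–(iv) block) AS TYPED at the genuine 𝔛-datum on the (H′) route, WITHOUT the
# coherence instance `hcoh` — node `IUTchI:Cor2.3(iii)` headline (row «COR23III-HPRIME-HEADLINE», holder abc-iut-w4-d058)

Mochizuki, *Inter-universal Teichmüller theory I: construction of Hodge theaters*, kurims manuscript (May 2020), §2,
Cor. 2.3 (iii) p. 47 l. 33–41 ("`Δ_{X,ℍ}` … `Π̂_{X,ℍ}` are slim … the natural exact sequences … of center-free groups"),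
proof p. 48 l. 36 – p. 49 l. 32; (iv) p. 47, proof p. 49 l. 33–34 [cite: Mochizuki2012, Cor 2.3(iii)(iv) pp.47-49] (D-0012
claim key; series status DISPUTED; the [IUTchI] items are `[claim: Mochizuki2012, status: disputed]`; PROVED below are the
displayed statements about the tree's own objects); Mochizuki, *Semi-graphs of anabelioids*, Publ. RIMS **42** (2006),
Ex. 3.10 pp. 44–45 (the per-vertex inputs) [cite: MochizukiSemiAnbd2006, Ex 3.10 pp.44-45]; [AbsAnab] Lemma 1.3.1 p. 15
(the (H′) centraliser fact, abc-iut-w4-d044's kernel theorem) [cite: MochizukiAbsAnab2004, Lemma 1.3.1 p.15].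

PROOF-ONLY by-name composition (abc-iut cell; seat abc-iut-w4-d058 gen 9, holder of record of node `IUTchI:Cor2.3(iii)`;
L5-lead g8 «L5 HUB (27)» 03:05Z names this base for the §2 (iii)/(2.5) lane).  abc-iut-w4-d052's (i)–(v) blocks on the
(H′) route (`…_of_hPrime`, p485924; `…_of_hPrime_of_inputs`, p486906) carry the FACT-INSTANCE `hcoh` ([SemiAnbd] Ex. 2.10
coherence of `G^c`) ONLY because they bundle Cor. 2.3 (v), whose M. Hall step uses it.  For (i)–(iv) — in particular for
the node (iii) — `hcoh` is not an input: this file composes abc-iut-w4-d052's `hcoh`-free (i)–(iv) block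
`cor23_i_to_iv_ofSpecialFibre_closureH_of_piData_of_mem_decompSubgroups` (p479637; `htp`, `hhat` theorems for
`Π^tp_ℍ ∈ decompSubgroups`) at the record's `ℍ := P.H` with `hHstab :=` the ORIGIN DATUM `P.ActGraphInduces`
(`hHstab_of_mem_decompSubgroups_of_actGraphInduces`, p485137) and the KER-LEVEL laws `hA`, `hB :=` the (H′) theorem
`kerLevel_ofSpecialFibre_of_isProSigmaCompletion_free` (p485924) fed, for the `_of_inputs` forms, by
`inf_ker_ne_bot_towerLevels_of_inputs` (p486906).

* `cor23_i_to_iv_ofSpecialFibre_closureH_of_piData_of_mem_decompSubgroups_of_hPrime` — (i)–(iv) from (x)/(y)/(z), NO `hcoh`;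
* `cor23_i_to_iv_ofSpecialFibre_closureH_of_piData_of_mem_decompSubgroups_of_hPrime_of_inputs` — (y) replaced by the
  per-vertex print inputs at one vertex per level;
* `cor23iii_ofSpecialFibre_closureH_of_piData_of_mem_decompSubgroups_of_hPrime(_of_inputs)` — **node `IUTchI:Cor2.3(iii)`
  AS TYPED**, the headline;
* `cor23iv_ofSpecialFibre_closureH_of_piData_of_mem_decompSubgroups_of_hPrime_of_inputs` — row (iv) with the same census.

BINDER CENSUS of the (iii) headline (classes of L5-lead RULINGS #101 (2) / #108 / #110): DATA = `X`, `d`, `S`, `Σ`/`Σ̂` +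
side conditions, `TpH`, `hTpH`, `cuspMeetsH`, `T`, `P`, (z) `hSig` («`Σ′` unbounded»; `Σ′ = Primes` in the [IUTchII]
Cor. 2.4 (i) application) · DATUM-INTERNAL = `h36`, `S.hyp`, the origin datum `hind : P.ActGraphInduces` · FACT-INSTANCE, IN
SHAPE = (x) `hΓ`/`hι` («`Δ̂_X` is a pro-`Σ′` completion of a nonabelian free group», AFFINE hyperbolic curve; GAP-LEDGER
G-w4d052-g6-2) and (y′) the per-vertex print inputs at ONE vertex per level `i` — `Jv`, `hJvJ`, `hJvc`, `hl : l ∉ Σ`, `L`,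
`ql`, `hqlc`, `hqls`, `hLl`, `hLnt`, `hSigv` ([SemiAnbd] Ex. 3.10 / print p. 48 l. 44 – p. 49 l. 5; GAP-LEDGER G-w4d052-g6-3
reduced, the currency of G-w4d058-1) · LAW = none · GONE versus the (i)–(v) blocks: `hcoh`.  HONEST LIMITS: the (H′) route
is NOT print's argument and does not cover finite `Σ̂` under guard (a) (there: abc-iut-w4-d052's `…_of_actGraphInduces_of_finite`
keeps LAW `{hA}`); the displayed inputs are hypotheses, not theorems; model-RELATIVE (∀ `X`, `d`, `S`); typed ≠ discharged
for the [IUTchI] claim key; no definition, no instance, no new `Prop` fact; nothing here bears on [IUTchIII] Cor. 3.12 or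
asserts that abc is proved or refuted.
-/

noncomputable section

namespace Literature.IUT.HodgeTheaters

open _root_.Topology
open scoped Pointwise
open Literature.AnabelianGeometry.SemiGraphs
open Literature.AnabelianGeometry.SemiGraphs.SemiGraphOfAnabelioids (IsProSigmaCompletion)

namespace StableCurveTemperedData

section Block

variable {p : ℕ} [Fact p.Prime] (X : TemperedCurve p) (d : X.GroupLevelData)
  (S : SpecialFibreData (X.toTemperedArithmeticGroup d)) (h36 : S.Gc.Prop36Hypotheses)
  (Sigma SigmaHat : Set ℕ) (hsub : Sigma ⊆ SigmaHat) (hne : Sigma.Nonempty)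
  (hprime : ∀ q ∈ SigmaHat, q.Prime) (hp : p ∉ Sigma)
  (TpH : Subgroup S.chart.G)
  (cuspMeetsH : {x : X.Pt // X.IsCusp x} → Prop)
  (T : SpecialFibreTower X.DeltaTemp)

/-! ### A. (i)–(iv) on the (H′) route without `hcoh` -/

/-- **[IUTchI] Cor. 2.3 (i)–(iv) AS TYPED at the genuine datum, `ℍ := P.H`, every `Π^tp_ℍ ∈ decompSubgroups S.chart P.H`,
KER-LEVEL laws `hA`, `hB` DISCHARGED via (H′)** from (x) `hι`, (z) `hSig`, (y) `hK`; `hHstab :=` the origin datum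
`P.ActGraphInduces`; NO coherence instance. [cite: Mochizuki2012, Cor 2.3 pp.47-49] -/
theorem cor23_i_to_iv_ofSpecialFibre_closureH_of_piData_of_mem_decompSubgroups_of_hPrime
    (P : SpecialFibreTower.PiData X d S T) (hTpH : TpH ∈ S.chart.decompSubgroups P.H)
    (hind : P.ActGraphInduces)
    {Γ : Type*} [Group Γ] [IsFreeGroup Γ] (hΓ : ∃ x y : Γ, x * y ≠ y * x) {Sig : Set ℕ}
    {ι : Γ →* (ofSpecialFibre X d S h36 Sigma SigmaHat hsub hne hprime hp TpH
      ((TpH.map (TemperedGraphGroupData.exists_completion_of_prop36 S.Gc h36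
        S.chart).choose_spec.choose.toMonoidHom).topologicalClosure) (Subgroup.le_topologicalClosure _) cuspMeetsH).DeltaHat}
    (hι : IsProSigmaCompletion Sig ι) (hSig : ∀ m : ℕ, ∃ q ∈ Sig, q.Prime ∧ m < q)
    (hK : ∀ i, ((OfSpecialFibre.towerOfSpecialFibreTower X d T Sigma SigmaHat hsub hne hprime S h36 hp TpH
        ((TpH.map (TemperedGraphGroupData.exists_completion_of_prop36 S.Gc h36
        S.chart).choose_spec.choose.toMonoidHom).topologicalClosure) (Subgroup.le_topologicalClosure _)
        cuspMeetsH).Jhat i).subgroupOf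
        (ofSpecialFibre X d S h36 Sigma SigmaHat hsub hne hprime hp TpH
      ((TpH.map (TemperedGraphGroupData.exists_completion_of_prop36 S.Gc h36
        S.chart).choose_spec.choose.toMonoidHom).topologicalClosure) (Subgroup.le_topologicalClosure _) cuspMeetsH).DeltaHat ⊓
        (ofSpecialFibre X d S h36 Sigma SigmaHat hsub hne hprime hp TpH
      ((TpH.map (TemperedGraphGroupData.exists_completion_of_prop36 S.Gc h36
        S.chart).choose_spec.choose.toMonoidHom).topologicalClosure) (Subgroup.le_topologicalClosure _) cuspMeetsH).ρHat.ker ≠ ⊥) :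
    ((ofSpecialFibre X d S h36 Sigma SigmaHat hsub hne hprime hp TpH
      ((TpH.map (TemperedGraphGroupData.exists_completion_of_prop36 S.Gc h36
        S.chart).choose_spec.choose.toMonoidHom).topologicalClosure) (Subgroup.le_topologicalClosure _) cuspMeetsH).Cor23i ∧
      (ofSpecialFibre X d S h36 Sigma SigmaHat hsub hne hprime hp TpH
      ((TpH.map (TemperedGraphGroupData.exists_completion_of_prop36 S.Gc h36
        S.chart).choose_spec.choose.toMonoidHom).topologicalClosure) (Subgroup.le_topologicalClosure _) cuspMeetsH).Cor23ii ∧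
      (ofSpecialFibre X d S h36 Sigma SigmaHat hsub hne hprime hp TpH
      ((TpH.map (TemperedGraphGroupData.exists_completion_of_prop36 S.Gc h36
        S.chart).choose_spec.choose.toMonoidHom).topologicalClosure) (Subgroup.le_topologicalClosure _) cuspMeetsH).Cor23iii ∧
      (ofSpecialFibre X d S h36 Sigma SigmaHat hsub hne hprime hp TpH
      ((TpH.map (TemperedGraphGroupData.exists_completion_of_prop36 S.Gc h36
        S.chart).choose_spec.choose.toMonoidHom).topologicalClosure) (Subgroup.le_topologicalClosure _) cuspMeetsH).Cor23iv) :=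
  have hKL := kerLevel_ofSpecialFibre_of_isProSigmaCompletion_free X d S h36 Sigma SigmaHat hsub hne hprime hp TpH
    ((TpH.map (TemperedGraphGroupData.exists_completion_of_prop36 S.Gc h36
        S.chart).choose_spec.choose.toMonoidHom).topologicalClosure) (Subgroup.le_topologicalClosure _) cuspMeetsH T hΓ hι
    hSig hK
  haveI := P.finite.finite_vertex_base
  haveI := P.finite.finite_edge_base
  haveI : Finite P.H.toSemiGraph.Vertex := inferInstanceAs (Finite P.H.verts)
  haveI : Finite P.H.toSemiGraph.Edge := inferInstanceAs (Finite P.H.edges)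
  cor23_i_to_iv_ofSpecialFibre_closureH_of_piData_of_mem_decompSubgroups X d S h36 Sigma SigmaHat hsub hne hprime hp TpH
    cuspMeetsH T P (fun _ => hKL) (fun _ => hKL) hTpH P.H_connected
    (ProfiniteSemiGraph.hasVertex_restrict_of_mem P.baseVertex_mem)
    (hHstab_of_mem_decompSubgroups_of_actGraphInduces X d S TpH T P hind hTpH)

/-- **The same with (y) DERIVED from the per-vertex print inputs at one vertex per level** (abc-iut-w4-d052's
`inf_ker_ne_bot_towerLevels_of_inputs`; side conditions `Δ̂_X` closed / `ρ̂` continuous / `Π̂_𝔾` Hausdorff discharged by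
abc-iut-L5's `ofSpecialFibre_*` lemmas). [cite: Mochizuki2012, Cor 2.3 pp.47-49] -/
theorem cor23_i_to_iv_ofSpecialFibre_closureH_of_piData_of_mem_decompSubgroups_of_hPrime_of_inputs
    (P : SpecialFibreTower.PiData X d S T) (hTpH : TpH ∈ S.chart.decompSubgroups P.H)
    (hind : P.ActGraphInduces)
    {Γ : Type*} [Group Γ] [IsFreeGroup Γ] (hΓ : ∃ x y : Γ, x * y ≠ y * x) {Sig : Set ℕ}
    {ι : Γ →* (ofSpecialFibre X d S h36 Sigma SigmaHat hsub hne hprime hp TpH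
      ((TpH.map (TemperedGraphGroupData.exists_completion_of_prop36 S.Gc h36
        S.chart).choose_spec.choose.toMonoidHom).topologicalClosure) (Subgroup.le_topologicalClosure _) cuspMeetsH).DeltaHat}
    (hι : IsProSigmaCompletion Sig ι) (hSig : ∀ m : ℕ, ∃ q ∈ Sig, q.Prime ∧ m < q)
    (Jv : ℕ → Subgroup (ofSpecialFibre X d S h36 Sigma SigmaHat hsub hne hprime hp TpH
      ((TpH.map (TemperedGraphGroupData.exists_completion_of_prop36 S.Gc h36
        S.chart).choose_spec.choose.toMonoidHom).topologicalClosure) (Subgroup.le_topologicalClosure _) cuspMeetsH).DeltaHat)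
    (hJvJ : ∀ i, Jv i ≤ ((OfSpecialFibre.towerOfSpecialFibreTower X d T Sigma SigmaHat hsub hne hprime S h36 hp TpH
        ((TpH.map (TemperedGraphGroupData.exists_completion_of_prop36 S.Gc h36
        S.chart).choose_spec.choose.toMonoidHom).topologicalClosure) (Subgroup.le_topologicalClosure _)
        cuspMeetsH).Jhat i).subgroupOf
        (ofSpecialFibre X d S h36 Sigma SigmaHat hsub hne hprime hp TpH
      ((TpH.map (TemperedGraphGroupData.exists_completion_of_prop36 S.Gc h36
        S.chart).choose_spec.choose.toMonoidHom).topologicalClosure) (Subgroup.le_topologicalClosure _) cuspMeetsH).DeltaHat)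
    (hJvc : ∀ i, IsClosed (Jv i : Set (ofSpecialFibre X d S h36 Sigma SigmaHat hsub hne hprime hp TpH
      ((TpH.map (TemperedGraphGroupData.exists_completion_of_prop36 S.Gc h36
        S.chart).choose_spec.choose.toMonoidHom).topologicalClosure) (Subgroup.le_topologicalClosure _) cuspMeetsH).DeltaHat))
    {l : ℕ} (hl : l ∉ Sigma)
    (L : ℕ → Type*) [∀ i, Group (L i)] [∀ i, TopologicalSpace (L i)] [∀ i, IsTopologicalGroup (L i)]
    [∀ i, CompactSpace (L i)] [∀ i, TotallyDisconnectedSpace (L i)]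
    (ql : ∀ i, Jv i →* L i) (hqlc : ∀ i, Continuous (ql i)) (hqls : ∀ i, Function.Surjective (ql i))
    (hLl : ∀ i, IsProSigma {l} (L i)) (hLnt : ∀ i, ∃ y : L i, y ≠ 1)
    (hSigv : ∀ i (M : Subgroup (Jv i)), M.Normal → IsOpen (M : Set (Jv i)) →
      ((ofSpecialFibre X d S h36 Sigma SigmaHat hsub hne hprime hp TpH
      ((TpH.map (TemperedGraphGroupData.exists_completion_of_prop36 S.Gc h36
        S.chart).choose_spec.choose.toMonoidHom).topologicalClosure) (Subgroup.le_topologicalClosure _) cuspMeetsH).ρHat.ker).subgroupOf (Jv i) ≤ M →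
      ∀ q : ℕ, q.Prime → q ∣ M.index → q ∈ Sigma) :
    ((ofSpecialFibre X d S h36 Sigma SigmaHat hsub hne hprime hp TpH
      ((TpH.map (TemperedGraphGroupData.exists_completion_of_prop36 S.Gc h36
        S.chart).choose_spec.choose.toMonoidHom).topologicalClosure) (Subgroup.le_topologicalClosure _) cuspMeetsH).Cor23i ∧
      (ofSpecialFibre X d S h36 Sigma SigmaHat hsub hne hprime hp TpH
      ((TpH.map (TemperedGraphGroupData.exists_completion_of_prop36 S.Gc h36
        S.chart).choose_spec.choose.toMonoidHom).topologicalClosure) (Subgroup.le_topologicalClosure _) cuspMeetsH).Cor23ii ∧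
      (ofSpecialFibre X d S h36 Sigma SigmaHat hsub hne hprime hp TpH
      ((TpH.map (TemperedGraphGroupData.exists_completion_of_prop36 S.Gc h36
        S.chart).choose_spec.choose.toMonoidHom).topologicalClosure) (Subgroup.le_topologicalClosure _) cuspMeetsH).Cor23iii ∧
      (ofSpecialFibre X d S h36 Sigma SigmaHat hsub hne hprime hp TpH
      ((TpH.map (TemperedGraphGroupData.exists_completion_of_prop36 S.Gc h36
        S.chart).choose_spec.choose.toMonoidHom).topologicalClosure) (Subgroup.le_topologicalClosure _) cuspMeetsH).Cor23iv) :=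
  haveI := ofSpecialFibre_t2Space_graphHat X d S h36 Sigma SigmaHat hsub hne hprime hp TpH
    ((TpH.map (TemperedGraphGroupData.exists_completion_of_prop36 S.Gc h36
        S.chart).choose_spec.choose.toMonoidHom).topologicalClosure) (Subgroup.le_topologicalClosure _) cuspMeetsH
  cor23_i_to_iv_ofSpecialFibre_closureH_of_piData_of_mem_decompSubgroups_of_hPrime X d S h36 Sigma SigmaHat hsub hne
    hprime hp TpH cuspMeetsH T P hTpH hind hΓ hι hSig
    (inf_ker_ne_bot_towerLevels_of_inputs _ _
      (ofSpecialFibre_isClosed_deltaHat X d S h36 Sigma SigmaHat hsub hne hprime hp TpH _ _ cuspMeetsH)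
      (ofSpecialFibre_continuous_ρHat X d S h36 Sigma SigmaHat hsub hne hprime hp TpH _ _ cuspMeetsH)
      Jv hJvJ hJvc hl L ql hqlc hqls hLl hLnt hSigv)

/-! ### B. Node `IUTchI:Cor2.3(iii)` — the headline, and row (iv) with the same census -/

/-- **NODE `IUTchI:Cor2.3(iii)` AS TYPED at the genuine 𝔛-datum** ("`Δ_{X,ℍ}`, `Π_{X,ℍ}` [tempered and profinite] are
slim; the natural sequences `1 → Δ_{X,ℍ} → Π_{X,ℍ} → G_k → 1` are exact, of center-free groups", under the typed
hypothesis `Cor23Hyp` (a)/(b)), for the record's `ℍ := P.H` and EVERY `Π^tp_ℍ ∈ decompSubgroups S.chart P.H`, print's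
`Π̂_ℍ :=` the closure of `ι(Π^tp_ℍ)`, on the (H′) route at unbounded `Σ′`: binders = DATA + the origin datum `hind` + the two
FACT-INSTANCE-shaped displayed inputs (x) `hΓ`/`hι` and (y) `hK`; LAW none; NO `hcoh`.
[cite: Mochizuki2012, Cor 2.3(iii) pp.47-49] -/
theorem cor23iii_ofSpecialFibre_closureH_of_piData_of_mem_decompSubgroups_of_hPrime
    (P : SpecialFibreTower.PiData X d S T) (hTpH : TpH ∈ S.chart.decompSubgroups P.H)
    (hind : P.ActGraphInduces)
    {Γ : Type*} [Group Γ] [IsFreeGroup Γ] (hΓ : ∃ x y : Γ, x * y ≠ y * x) {Sig : Set ℕ}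
    {ι : Γ →* (ofSpecialFibre X d S h36 Sigma SigmaHat hsub hne hprime hp TpH
      ((TpH.map (TemperedGraphGroupData.exists_completion_of_prop36 S.Gc h36
        S.chart).choose_spec.choose.toMonoidHom).topologicalClosure) (Subgroup.le_topologicalClosure _) cuspMeetsH).DeltaHat}
    (hι : IsProSigmaCompletion Sig ι) (hSig : ∀ m : ℕ, ∃ q ∈ Sig, q.Prime ∧ m < q)
    (hK : ∀ i, ((OfSpecialFibre.towerOfSpecialFibreTower X d T Sigma SigmaHat hsub hne hprime S h36 hp TpH
        ((TpH.map (TemperedGraphGroupData.exists_completion_of_prop36 S.Gc h36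
        S.chart).choose_spec.choose.toMonoidHom).topologicalClosure) (Subgroup.le_topologicalClosure _)
        cuspMeetsH).Jhat i).subgroupOf
        (ofSpecialFibre X d S h36 Sigma SigmaHat hsub hne hprime hp TpH
      ((TpH.map (TemperedGraphGroupData.exists_completion_of_prop36 S.Gc h36
        S.chart).choose_spec.choose.toMonoidHom).topologicalClosure) (Subgroup.le_topologicalClosure _) cuspMeetsH).DeltaHat ⊓
        (ofSpecialFibre X d S h36 Sigma SigmaHat hsub hne hprime hp TpH
      ((TpH.map (TemperedGraphGroupData.exists_completion_of_prop36 S.Gc h36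
        S.chart).choose_spec.choose.toMonoidHom).topologicalClosure) (Subgroup.le_topologicalClosure _) cuspMeetsH).ρHat.ker ≠ ⊥) :
    (ofSpecialFibre X d S h36 Sigma SigmaHat hsub hne hprime hp TpH
      ((TpH.map (TemperedGraphGroupData.exists_completion_of_prop36 S.Gc h36
        S.chart).choose_spec.choose.toMonoidHom).topologicalClosure) (Subgroup.le_topologicalClosure _) cuspMeetsH).Cor23iii :=
  (cor23_i_to_iv_ofSpecialFibre_closureH_of_piData_of_mem_decompSubgroups_of_hPrime X d S h36 Sigma SigmaHat hsub hne
    hprime hp TpH cuspMeetsH T P hTpH hind hΓ hι hSig hK).2.2.1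

/-- **NODE `IUTchI:Cor2.3(iii)` AS TYPED at the genuine 𝔛-datum, (y) from the PER-VERTEX PRINT INPUTS** at one vertex per
tower level ([SemiAnbd] Ex. 3.10: the decomposition group `J_v ≤ Ĵ_i ∩ Δ̂_X` of a vertex, closed, with a continuous
surjection onto a non-trivial pro-`l` group, `l ∉ Σ`, and pro-`Σ` image in `Π̂_𝔾`) — THE HEADLINE of row
«COR23III-HPRIME-HEADLINE»: binders = DATA + DATUM-INTERNAL {`h36`, `S.hyp`, `hind`} + FACT-INSTANCE-shaped {(x), (y′)} at
unbounded `Σ′` (z); LAW none; NO `hcoh`. [cite: Mochizuki2012, Cor 2.3(iii) pp.47-49] -/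
theorem cor23iii_ofSpecialFibre_closureH_of_piData_of_mem_decompSubgroups_of_hPrime_of_inputs
    (P : SpecialFibreTower.PiData X d S T) (hTpH : TpH ∈ S.chart.decompSubgroups P.H)
    (hind : P.ActGraphInduces)
    {Γ : Type*} [Group Γ] [IsFreeGroup Γ] (hΓ : ∃ x y : Γ, x * y ≠ y * x) {Sig : Set ℕ}
    {ι : Γ →* (ofSpecialFibre X d S h36 Sigma SigmaHat hsub hne hprime hp TpH
      ((TpH.map (TemperedGraphGroupData.exists_completion_of_prop36 S.Gc h36
        S.chart).choose_spec.choose.toMonoidHom).topologicalClosure) (Subgroup.le_topologicalClosure _) cuspMeetsH).DeltaHat}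
    (hι : IsProSigmaCompletion Sig ι) (hSig : ∀ m : ℕ, ∃ q ∈ Sig, q.Prime ∧ m < q)
    (Jv : ℕ → Subgroup (ofSpecialFibre X d S h36 Sigma SigmaHat hsub hne hprime hp TpH
      ((TpH.map (TemperedGraphGroupData.exists_completion_of_prop36 S.Gc h36
        S.chart).choose_spec.choose.toMonoidHom).topologicalClosure) (Subgroup.le_topologicalClosure _) cuspMeetsH).DeltaHat)
    (hJvJ : ∀ i, Jv i ≤ ((OfSpecialFibre.towerOfSpecialFibreTower X d T Sigma SigmaHat hsub hne hprime S h36 hp TpH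
        ((TpH.map (TemperedGraphGroupData.exists_completion_of_prop36 S.Gc h36
        S.chart).choose_spec.choose.toMonoidHom).topologicalClosure) (Subgroup.le_topologicalClosure _)
        cuspMeetsH).Jhat i).subgroupOf
        (ofSpecialFibre X d S h36 Sigma SigmaHat hsub hne hprime hp TpH
      ((TpH.map (TemperedGraphGroupData.exists_completion_of_prop36 S.Gc h36
        S.chart).choose_spec.choose.toMonoidHom).topologicalClosure) (Subgroup.le_topologicalClosure _) cuspMeetsH).DeltaHat)
    (hJvc : ∀ i, IsClosed (Jv i : Set (ofSpecialFibre X d S h36 Sigma SigmaHat hsub hne hprime hp TpH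
      ((TpH.map (TemperedGraphGroupData.exists_completion_of_prop36 S.Gc h36
        S.chart).choose_spec.choose.toMonoidHom).topologicalClosure) (Subgroup.le_topologicalClosure _) cuspMeetsH).DeltaHat))
    {l : ℕ} (hl : l ∉ Sigma)
    (L : ℕ → Type*) [∀ i, Group (L i)] [∀ i, TopologicalSpace (L i)] [∀ i, IsTopologicalGroup (L i)]
    [∀ i, CompactSpace (L i)] [∀ i, TotallyDisconnectedSpace (L i)]
    (ql : ∀ i, Jv i →* L i) (hqlc : ∀ i, Continuous (ql i)) (hqls : ∀ i, Function.Surjective (ql i))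
    (hLl : ∀ i, IsProSigma {l} (L i)) (hLnt : ∀ i, ∃ y : L i, y ≠ 1)
    (hSigv : ∀ i (M : Subgroup (Jv i)), M.Normal → IsOpen (M : Set (Jv i)) →
      ((ofSpecialFibre X d S h36 Sigma SigmaHat hsub hne hprime hp TpH
      ((TpH.map (TemperedGraphGroupData.exists_completion_of_prop36 S.Gc h36
        S.chart).choose_spec.choose.toMonoidHom).topologicalClosure) (Subgroup.le_topologicalClosure _) cuspMeetsH).ρHat.ker).subgroupOf (Jv i) ≤ M →
      ∀ q : ℕ, q.Prime → q ∣ M.index → q ∈ Sigma) :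
    (ofSpecialFibre X d S h36 Sigma SigmaHat hsub hne hprime hp TpH
      ((TpH.map (TemperedGraphGroupData.exists_completion_of_prop36 S.Gc h36
        S.chart).choose_spec.choose.toMonoidHom).topologicalClosure) (Subgroup.le_topologicalClosure _) cuspMeetsH).Cor23iii :=
  (cor23_i_to_iv_ofSpecialFibre_closureH_of_piData_of_mem_decompSubgroups_of_hPrime_of_inputs X d S h36 Sigma SigmaHat
    hsub hne hprime hp TpH cuspMeetsH T P hTpH hind hΓ hι hSig Jv hJvJ hJvc hl L ql hqlc hqls hLl hLnt hSigv).2.2.1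

/-- **Row `IUTchI:Cor2.3(iv)` AS TYPED at the genuine 𝔛-datum on the (H′) route with (y) from the per-vertex inputs and NO
`hcoh`** — the census of the (iv) token of CONE-L5-STATUS v2.3 minus the coherence instance.
[cite: Mochizuki2012, Cor 2.3(iv) p.49] -/
theorem cor23iv_ofSpecialFibre_closureH_of_piData_of_mem_decompSubgroups_of_hPrime_of_inputs
    (P : SpecialFibreTower.PiData X d S T) (hTpH : TpH ∈ S.chart.decompSubgroups P.H)
    (hind : P.ActGraphInduces)
    {Γ : Type*} [Group Γ] [IsFreeGroup Γ] (hΓ : ∃ x y : Γ, x * y ≠ y * x) {Sig : Set ℕ}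
    {ι : Γ →* (ofSpecialFibre X d S h36 Sigma SigmaHat hsub hne hprime hp TpH
      ((TpH.map (TemperedGraphGroupData.exists_completion_of_prop36 S.Gc h36
        S.chart).choose_spec.choose.toMonoidHom).topologicalClosure) (Subgroup.le_topologicalClosure _) cuspMeetsH).DeltaHat}
    (hι : IsProSigmaCompletion Sig ι) (hSig : ∀ m : ℕ, ∃ q ∈ Sig, q.Prime ∧ m < q)
    (Jv : ℕ → Subgroup (ofSpecialFibre X d S h36 Sigma SigmaHat hsub hne hprime hp TpH
      ((TpH.map (TemperedGraphGroupData.exists_completion_of_prop36 S.Gc h36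
        S.chart).choose_spec.choose.toMonoidHom).topologicalClosure) (Subgroup.le_topologicalClosure _) cuspMeetsH).DeltaHat)
    (hJvJ : ∀ i, Jv i ≤ ((OfSpecialFibre.towerOfSpecialFibreTower X d T Sigma SigmaHat hsub hne hprime S h36 hp TpH
        ((TpH.map (TemperedGraphGroupData.exists_completion_of_prop36 S.Gc h36
        S.chart).choose_spec.choose.toMonoidHom).topologicalClosure) (Subgroup.le_topologicalClosure _)
        cuspMeetsH).Jhat i).subgroupOf
        (ofSpecialFibre X d S h36 Sigma SigmaHat hsub hne hprime hp TpH
      ((TpH.map (TemperedGraphGroupData.exists_completion_of_prop36 S.Gc h36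
        S.chart).choose_spec.choose.toMonoidHom).topologicalClosure) (Subgroup.le_topologicalClosure _) cuspMeetsH).DeltaHat)
    (hJvc : ∀ i, IsClosed (Jv i : Set (ofSpecialFibre X d S h36 Sigma SigmaHat hsub hne hprime hp TpH
      ((TpH.map (TemperedGraphGroupData.exists_completion_of_prop36 S.Gc h36
        S.chart).choose_spec.choose.toMonoidHom).topologicalClosure) (Subgroup.le_topologicalClosure _) cuspMeetsH).DeltaHat))
    {l : ℕ} (hl : l ∉ Sigma)
    (L : ℕ → Type*) [∀ i, Group (L i)] [∀ i, TopologicalSpace (L i)] [∀ i, IsTopologicalGroup (L i)]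
    [∀ i, CompactSpace (L i)] [∀ i, TotallyDisconnectedSpace (L i)]
    (ql : ∀ i, Jv i →* L i) (hqlc : ∀ i, Continuous (ql i)) (hqls : ∀ i, Function.Surjective (ql i))
    (hLl : ∀ i, IsProSigma {l} (L i)) (hLnt : ∀ i, ∃ y : L i, y ≠ 1)
    (hSigv : ∀ i (M : Subgroup (Jv i)), M.Normal → IsOpen (M : Set (Jv i)) →
      ((ofSpecialFibre X d S h36 Sigma SigmaHat hsub hne hprime hp TpH
      ((TpH.map (TemperedGraphGroupData.exists_completion_of_prop36 S.Gc h36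
        S.chart).choose_spec.choose.toMonoidHom).topologicalClosure) (Subgroup.le_topologicalClosure _) cuspMeetsH).ρHat.ker).subgroupOf (Jv i) ≤ M →
      ∀ q : ℕ, q.Prime → q ∣ M.index → q ∈ Sigma) :
    (ofSpecialFibre X d S h36 Sigma SigmaHat hsub hne hprime hp TpH
      ((TpH.map (TemperedGraphGroupData.exists_completion_of_prop36 S.Gc h36
        S.chart).choose_spec.choose.toMonoidHom).topologicalClosure) (Subgroup.le_topologicalClosure _) cuspMeetsH).Cor23iv :=
  (cor23_i_to_iv_ofSpecialFibre_closureH_of_piData_of_mem_decompSubgroups_of_hPrime_of_inputs X d S h36 Sigma SigmaHat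
    hsub hne hprime hp TpH cuspMeetsH T P hTpH hind hΓ hι hSig Jv hJvJ hJvc hl L ql hqlc hqls hLl hLnt hSigv).2.2.2

end Block

end StableCurveTemperedData

end Literature.IUT.HodgeTheaters

end
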